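/-
Copyright (c) 2026. All rights reserved.
Released under Apache 2.0 license as described in the file LICENSE.
Authors: abc-iut cell, wave-4 cone prover seat abc-iut-w4-d017 (gen 3); node IUTchIII:Rmk1.3.2
(FACT-LIST F-2068, «R11: prove or GAP»), pinned at [IUTchIII] Cor 3.12 Step (vi) and
SUBDAG-IUTchIII-Prop-34 row ii.r15.
-/
import Mathlib.Analysis.Complex.Basic
import Mathlib.Analysis.Complex.Exponential
import Literature.IUT.LogVolume.LocalUnitLogEquivariance
import Literature.IUT.HodgeArakelov.Cor4546SubdagStatements
import Literature.IUT.LogThetaLattice.LogWallRemarks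
import HarnessLib

/-!
# [IUTchIII] Remark 1.3.2 at the genuine local models: the log-link commutes with the
# `𝔽_l^{⋊±}`-symmetrizing isomorphisms

S. Mochizuki, *Inter-universal Teichmüller theory III*, kurims manuscript (May 2020), render
`paper:url-4b091feeb646`, Remark 1.3.2 pp. 43 l. 43 – 44 l. 2 [claim key `Mochizuki2012`, D-0012, status
disputed]: "one verifies immediately that the log-links associated, in the construction of Proposition
1.3, (i), to these `F`-prime-strips `†F_t`, for `t ∈ T` — i.e., more precisely, associated to the labeled
collections of monoids `Ψ_cns(†𝔉_≻)_t` of [IUTchII], Corollary 4.6, (iii) — are in fact compatible with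
the `𝔽_l^{⋊±}`-symmetrizing isomorphisms discussed in [IUTchII], Corollary 4.6, (iii), hence also with
the conjugate synchronization determined by these `𝔽_l^{⋊±}`-symmetrizing isomorphisms — cf. the
discussion of Step (vi) of the proof of Corollary 3.12 of §3 below. We leave the routine details to the
reader."  The mechanism is printed at Rmk 1.2.2 (i), p. 30 l. 1–6: "by applying the Galois-equivariance
of the power series defining the `p_v`-adic logarithm to relate automorphisms of the monoid `Ψ_{†F_v}` to
[induced!] automorphisms of the monoid `Ψ~_{†F_v} = Ψ^{gp}_{log(†F_v)}`"; at `v ∈ V^{arc}` the log-link is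
built from the universal covering `Ψ~_{†F_v} ↠ Ψ^{gp}_{†F_v}` of `ℂ^×`, i.e. the complex exponential
(Def 1.1 (ii), p. 25).

**What the tree had.** The remark is typed as the SCHEMA `Rmk132_logLinkCompatible M N lg σ τ`
(`LogWallRemarks.lean`, abc-iut-L6-t1: a label-indexed family of maps commuting with two families of
symmetrising bijections), recorded in the cell's FACT-LIST as F-2068, class «IUTch · R11: Remark inside
the Cor 3.12 closure — prove or GAP», status fact-open, parametrised.  `RemarkSchemaClosures.lean`
(abc-iut-w5-d117) certifies that the universal closure of the schema is FALSE
(`not_forall_Rmk132_logLinkCompatible`) and that the label-INDEPENDENT instance (identity symmetrising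
bijections) holds by `rfl` (`Rmk132_logLinkCompatible_of_labelIndependent`) — a degenerate instance.

**What this file proves (proof-only: no `def`, no new named fact).** The GENUINE instances, i.e. the
schema at the cell's local models of the log-link with NON-TRIVIAL symmetrizing isomorphisms:

* §1 (nonarchimedean, Def 1.1 (i)): for a family of labeled complete `p`-adic fields `K_t` and
  symmetrizing isomorphisms given by NORM-PRESERVING ring isomorphisms `ι_{γ,t} : K_t ⥲ K_{γ·t}` (at the
  model the `𝔽_l^{⋊±}`-symmetrizing isomorphisms of [IUTchII] Cor 4.6 (iii) / Cor 3.5 (i) are induced by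
  conjugation by elements of `Π_v`, which act on `Ψ_cns = 𝒪^▷` through `G_v`, i.e. by isometric field
  automorphisms), the log-link `log_p = Literature.IUT.LogVolume.unitLog` (abc-iut-S1) satisfies the
  schema: `Rmk132_logLinkCompatible_unitLog` (all of `K_t`), `…_unitLog_units` (on the unit groups
  `𝒪^×_{K_t} = Ψ^×`), `…_unitLog_galois` (one field, `Gal(K/ℚ_p)`-valued transports, hypothesis-free) —
  from the naturality of the `p`-adic logarithm `Literature.IUT.LogVolume.unitLog_map` /
  `unitLog_map_algEquiv` (abc-iut-w5-d242), consumed BY NAME; and the log-shells are carried onto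
  log-shells (`symmetrizing_image_logShell`).
* §2 (archimedean, Def 1.1 (ii)): `Complex.exp` commutes with every `ℝ`-algebra automorphism of `ℂ`
  (`Complex.exp_map_real_algEquiv`, from Mathlib's `Complex.real_algHom_eq_id_or_conj` and
  `Complex.exp_conj`), whence the schema for `Aut(ℂ/ℝ)`-valued transports
  (`Rmk132_logLinkCompatible_cexp`).
* §3 (junction to the [IUTchII] Cor 4.5 (iii) / 4.6 (iii) vocabulary of
  `Literature.IUT.HodgeArakelov.SymmetrizingIsos` / `ActionTransport`, abc-iut-w5-d118 / w5-d100): a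
  family of maps equivariant for two `ActionTransport`s satisfies the schema for the transports
  (`Rmk132_logLinkCompatible_of_actionTransport`) and is compatible with the INDUCED systems of
  symmetrizing isomorphisms (`compatible_toSymmetrizingIsos`); a family compatible with two systems of
  symmetrizing isomorphisms carries DIAGONAL families to diagonal families and commutes with
  `toDiagonal` (`SymmetrizingIsos.map_mem_diagonal`, `SymmetrizingIsos.map_toDiagonal`) — "hence also
  with the conjugate synchronization", the form in which [IUTchIII] Prop 3.4 (ii) / Cor 3.12 Step (vi)
  consume the remark (transport of the diagonal submonoids `Ψ_{⟨|𝔽_l|⟩}`, `Ψ_{⟨𝔽_l^⋇⟩}` through the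
  log-link).
* §4 (the model instance of §3): for `ActionTransport`s on labeled copies of one complete algebraic
  `p`-adic field whose transports are Galois automorphisms `φ γ`, `log_p` is equivariant
  (`unitLog_actionTransport_equivariant`), hence satisfies the schema for the transports
  (`Rmk132_logLinkCompatible_unitLog_actionTransport`), is compatible with the induced symmetrizing
  isomorphisms (`unitLog_compatible_toSymmetrizingIsos`) and carries diagonal (= conjugate-synchronized)
  families to diagonal families (`unitLog_map_mem_diagonal`); such genuine, non-identity transports EXIST
  (regular label action, any `φ : Γ →* Gal(K/ℚ_p)`: `exists_actionTransport_galois`).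

HONEST FRAMING.  This is the routine verification the remark leaves to the reader, carried out at the
cell's MODELS of the local data (`unitLog`, `Complex.exp`); it identifies no object of [IUTchII] §4 with
these models (that identification is the L6 merge debt recorded in plan/L6/MERGE-MAP.md) and bears in no
way on the disputed inequality of [IUTchIII] Cor 3.12; no side is taken. typed ≠ proved elsewhere;
here: proved at the model.
-/

set_option autoImplicit false

noncomputable section

namespace Literature.IUT.LogThetaLattice

open Literature.IUT.HodgeArakelov Literature.IUT.LogVolume
open Literature.AnabelianGeometry.AbsoluteAnabelian (PadicLogOnUnits PadicLogOnUnits.ofUnitLog logShell)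

universe u v w

/-! ## §1. Nonarchimedean places: naturality of the `p`-adic logarithm (Def 1.1 (i), Rmk 1.2.2 (i)) -/

section Nonarch

variable (p : ℕ) [Fact p.Prime]

/-- **[IUTchIII] Rmk 1.3.2 at the nonarchimedean model, whole field.** Labeled complete `p`-adic fields
`K_t` (`t ∈ T`), a group `Γ` acting on the labels (`𝔽_l^{⋊±} ↷ LabCusp^±`), and symmetrizing
isomorphisms `ι_{γ,t} : K_t ⥲ K_{γ·t}` which are norm-preserving ring isomorphisms (conjugation by
`Π_v` acts on `𝒪^▷_{F̄_v}` through isometric field automorphisms): the log-link `log_p` on `K_t` (junk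
value `0` off the units) commutes with them — the schema `Rmk132_logLinkCompatible` HOLDS, by the
Galois-equivariance / naturality of the `p_v`-adic logarithm (`unitLog_map`).
[claim: Mochizuki2012, status: disputed] (IUTchIII §1 Rmk 1.3.2, kurims pp.43–44; Rmk 1.2.2 (i) p.30) -/
theorem Rmk132_logLinkCompatible_unitLog {T : Type u} (K : T → Type u)
    [∀ t, NontriviallyNormedField (K t)] [∀ t, NormedAlgebra ℚ_[p] (K t)]
    [∀ t, IsUltrametricDist (K t)] [∀ t, CompleteSpace (K t)]
    {Γ : Type u} [Group Γ] [MulAction Γ T]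
    (ι : ∀ (γ : Γ) (t : T), K t ≃+* K (γ • t)) (hι : ∀ (γ : Γ) (t : T) (x : K t), ‖ι γ t x‖ = ‖x‖) :
    Rmk132_logLinkCompatible K K (fun t => (unitLog : K t → K t))
      (fun γ t => (ι γ t).toEquiv) (fun γ t => (ι γ t).toEquiv) :=
  fun γ t x => unitLog_map p ((ι γ t : K t ≃+* K (γ • t)) : K t →+* K (γ • t)) (hι γ t) x

/-- A norm-preserving ring isomorphism restricts to a bijection of the unit groups
`𝒪^×_K = {‖x‖ = 1}` (`Ψ^×_{†F_v}`), used to state the schema on the units.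
[claim: Mochizuki2012, status: disputed] (IUTchIII §1 Def 1.1 (i), kurims p.24) -/
theorem norm_eq_one_iff_of_norm_map {K K' : Type*} [NontriviallyNormedField K]
    [NontriviallyNormedField K'] (σ : K ≃+* K') (hσ : ∀ x, ‖σ x‖ = ‖x‖) (x : K) :
    ‖x‖ = 1 ↔ ‖σ.toEquiv x‖ = 1 := by
  show ‖x‖ = 1 ↔ ‖σ x‖ = 1
  rw [hσ]

/-- **[IUTchIII] Rmk 1.3.2 at the nonarchimedean model, on the unit groups `Ψ^× = 𝒪^×`.** Same data as
`Rmk132_logLinkCompatible_unitLog`; the log-link is `log_p : 𝒪^×_{K_t} → K_t = Ψ~` (Def 1.1 (i)) and the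
symmetrizing bijections on the units are the restrictions of the `ι_{γ,t}`.
[claim: Mochizuki2012, status: disputed] (IUTchIII §1 Rmk 1.3.2, kurims pp.43–44) -/
theorem Rmk132_logLinkCompatible_unitLog_units {T : Type u} (K : T → Type u)
    [∀ t, NontriviallyNormedField (K t)] [∀ t, NormedAlgebra ℚ_[p] (K t)]
    [∀ t, IsUltrametricDist (K t)] [∀ t, CompleteSpace (K t)]
    {Γ : Type u} [Group Γ] [MulAction Γ T]
    (ι : ∀ (γ : Γ) (t : T), K t ≃+* K (γ • t)) (hι : ∀ (γ : Γ) (t : T) (x : K t), ‖ι γ t x‖ = ‖x‖) :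
    Rmk132_logLinkCompatible (fun t => {x : K t // ‖x‖ = 1}) K
      (fun t (x : {x : K t // ‖x‖ = 1}) => unitLog (x : K t))
      (fun γ t => (ι γ t).toEquiv.subtypeEquiv (norm_eq_one_iff_of_norm_map (ι γ t) (hι γ t)))
      (fun γ t => (ι γ t).toEquiv) :=
  fun γ t x => unitLog_map p ((ι γ t : K t ≃+* K (γ • t)) : K t →+* K (γ • t)) (hι γ t) x

/-- **[IUTchIII] Rmk 1.3.2 at the nonarchimedean model, Galois form, hypothesis-free.** One complete
algebraic `p`-adic field `K` carrying every label, transports `ρ_{γ,t} ∈ Gal(K/ℚ_p)` (ARBITRARY — no cocycle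
or synchronization condition is needed for the compatibility itself): `log_p (ρ x) = ρ (log_p x)`.
[claim: Mochizuki2012, status: disputed] (IUTchIII §1 Rmk 1.3.2, kurims pp.43–44; Rmk 1.2.2 (i) p.30) -/
theorem Rmk132_logLinkCompatible_unitLog_galois {T : Type u} {K : Type u} [NontriviallyNormedField K]
    [NormedAlgebra ℚ_[p] K] [Algebra.IsAlgebraic ℚ_[p] K] [IsUltrametricDist K] [CompleteSpace K]
    {Γ : Type u} [Group Γ] [MulAction Γ T] (ρ : Γ → T → (K ≃ₐ[ℚ_[p]] K)) :
    Rmk132_logLinkCompatible (fun _ : T => K) (fun _ => K) (fun _ => (unitLog : K → K))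
      (fun γ t => (ρ γ t).toEquiv) (fun γ t => (ρ γ t).toEquiv) :=
  fun γ t x => unitLog_map_algEquiv p (ρ γ t) x

/-- **Compatibility with log-shells** (Rmk 1.3.2 read together with Prop 1.2 (vi) / Prop 1.3 (iii)): a
norm-preserving symmetrizing isomorphism carries the pre-log-shell `log_p(𝒪^×_{K_t})` and the log-shell
`ℐ_{K_t} = (p*)⁻¹·log_p(𝒪^×_{K_t})` of the standard model onto those of `K_{γ·t}` (`image_logUnits`,
`image_logShell_ofUnitLog`, abc-iut-w5-d242, BY NAME).
[claim: Mochizuki2012, status: disputed] (IUTchIII §1 Rmk 1.3.2, kurims pp.43–44; Prop 1.3 (iii) p.42) -/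
theorem symmetrizing_image_logShell {T : Type u} (K : T → Type u)
    [∀ t, NontriviallyNormedField (K t)] [∀ t, NormedAlgebra ℚ_[p] (K t)]
    [∀ t, IsUltrametricDist (K t)] [∀ t, CompleteSpace (K t)]
    {Γ : Type u} [Group Γ] [MulAction Γ T]
    (ι : ∀ (γ : Γ) (t : T), K t ≃+* K (γ • t)) (hι : ∀ (γ : Γ) (t : T) (x : K t), ‖ι γ t x‖ = ‖x‖)
    (γ : Γ) (t : T) :
    ι γ t '' logUnits (K t) = logUnits (K (γ • t)) ∧
      ι γ t '' logShell (PadicLogOnUnits.ofUnitLog p (K t))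
        = logShell (PadicLogOnUnits.ofUnitLog p (K (γ • t))) :=
  ⟨image_logUnits p (ι γ t) (hι γ t), image_logShell_ofUnitLog p (ι γ t) (hι γ t)⟩

end Nonarch

/-! ## §2. Archimedean places: the exponential commutes with `Aut(ℂ/ℝ)` (Def 1.1 (ii)) -/

section Arch

open Complex

/-- Every `ℝ`-algebra endomorphism of `ℂ` (the identity or complex conjugation,
`Complex.real_algHom_eq_id_or_conj`) commutes with the complex exponential — the universal covering
`Ψ~_{†F_v} ↠ Ψ^{gp}_{†F_v}` of Def 1.1 (ii) is natural in the topological field `ℂ`.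
[claim: Mochizuki2012, status: disputed] (IUTchIII §1 Def 1.1 (ii), kurims p.25) -/
theorem Complex.exp_map_real_algHom (f : ℂ →ₐ[ℝ] ℂ) (z : ℂ) : exp (f z) = f (exp z) := by
  rcases Complex.real_algHom_eq_id_or_conj f with rfl | rfl
  · rfl
  · exact Complex.exp_conj z

/-- `ℝ`-algebra AUTOMORPHISMS of `ℂ` commute with the complex exponential.
[claim: Mochizuki2012, status: disputed] (IUTchIII §1 Def 1.1 (ii), kurims p.25) -/
theorem Complex.exp_map_real_algEquiv (σ : ℂ ≃ₐ[ℝ] ℂ) (z : ℂ) : exp (σ z) = σ (exp z) :=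
  Complex.exp_map_real_algHom (σ : ℂ →ₐ[ℝ] ℂ) z

/-- **[IUTchIII] Rmk 1.3.2 at the archimedean model.** Labels `t ∈ T` all carrying the complex
archimedean field `ℂ`, transports `ρ_{γ,t} ∈ Aut(ℂ/ℝ)` (arbitrary): the universal-covering map `exp` of
Def 1.1 (ii) commutes with them, so the schema `Rmk132_logLinkCompatible` HOLDS.
[claim: Mochizuki2012, status: disputed] (IUTchIII §1 Rmk 1.3.2, kurims pp.43–44; Rmk 1.2.2 (ii) p.30) -/
theorem Rmk132_logLinkCompatible_cexp {T : Type} {Γ : Type} [Group Γ] [MulAction Γ T]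
    (ρ : Γ → T → (ℂ ≃ₐ[ℝ] ℂ)) :
    Rmk132_logLinkCompatible (fun _ : T => ℂ) (fun _ => ℂ) (fun _ => Complex.exp)
      (fun γ t => (ρ γ t).toEquiv) (fun γ t => (ρ γ t).toEquiv) :=
  fun γ t z => Complex.exp_map_real_algEquiv (ρ γ t) z

end Arch

/-! ## §3. Junction to [IUTchII] Cor 4.5 (iii) / 4.6 (iii): transports, symmetrizing isomorphisms,
diagonal submonoids -/

section Junction

variable {T : Type u} {Γ : Type w} [Group Γ] [MulAction Γ T]
variable {Ψ : T → Type v} {N : T → Type v} [∀ t, CommMonoid (Ψ t)] [∀ t, CommMonoid (N t)]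

/-- **The schema from transport data.** If the symmetrizing isomorphisms on BOTH sides of the log-link
are the transports of `ActionTransport`s ([IUTchII] Cor 4.5 (iii): "the various local `𝔽_l^{⋊±}`-actions
… induce isomorphisms between the labeled data") and the maps `lg_t` are EQUIVARIANT for these
transports, then `Rmk132_logLinkCompatible` holds for the transports along `γ : t ↦ γ·t`.
[claim: Mochizuki2012, status: disputed] (IUTchIII §1 Rmk 1.3.2, kurims pp.43–44) -/
theorem Rmk132_logLinkCompatible_of_actionTransport {T : Type u} {Γ : Type u} [Group Γ]
    [MulAction Γ T] {Ψ N : T → Type u} [∀ t, CommMonoid (Ψ t)] [∀ t, CommMonoid (N t)]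
    (A : ActionTransport Γ Ψ) (B : ActionTransport Γ N) (lg : ∀ t, Ψ t → N t)
    (hlg : ∀ (g : Γ) (t t' : T) (h : g • t = t') (x : Ψ t),
      lg t' (A.act g t t' h x) = B.act g t t' h (lg t x)) :
    Rmk132_logLinkCompatible Ψ N lg (fun γ t => (A.act γ t (γ • t) rfl).toEquiv)
      (fun γ t => (B.act γ t (γ • t) rfl).toEquiv) :=
  fun γ t x => hlg γ t (γ • t) rfl x

/-- **Equivariance for transports ⇒ compatibility with the INDUCED symmetrizing isomorphisms.** If
`lg_t : Ψ_t → N_t` intertwines the transports of `A` (domains) and `B` (codomains) along every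
`g : t ↦ t'`, then it intertwines the induced systems of symmetrizing isomorphisms `σ_{t,t'}`
(`ActionTransport.toSymmetrizingIsos`, well-defined by conjugate synchronization).
[claim: Mochizuki2012, status: disputed] (IUTchIII §1 Rmk 1.3.2, kurims pp.43–44) -/
theorem compatible_toSymmetrizingIsos [MulAction.IsPretransitive Γ T]
    (A : ActionTransport Γ Ψ) (B : ActionTransport Γ N) (lg : ∀ t, Ψ t → N t)
    (hlg : ∀ (g : Γ) (t t' : T) (h : g • t = t') (x : Ψ t),
      lg t' (A.act g t t' h x) = B.act g t t' h (lg t x))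
    (t t' : T) (x : Ψ t) :
    lg t' (A.toSymmetrizingIsos.iso t t' x) = B.toSymmetrizingIsos.iso t t' (lg t x) := by
  obtain ⟨g, hg⟩ := MulAction.exists_smul_eq Γ t t'
  rw [A.toSymmetrizingIsos_iso_apply g t t' hg, B.toSymmetrizingIsos_iso_apply g t t' hg, hlg]

variable (σ : SymmetrizingIsos Ψ) (τ : SymmetrizingIsos N)

/-- **"hence also with the conjugate synchronization": diagonal families go to diagonal families.** A
family of maps `lg_t : Ψ_t → N_t` compatible with two systems of symmetrizing isomorphisms carries the
diagonal submonoid `Ψ_{⟨S⟩} ⊆ ∏_{s} Ψ_{e(s)}` ([IUTchII] Cor 4.5 (iii) / 4.6 (iii): `Ψ_{⟨|𝔽_l|⟩}`,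
`Ψ_{⟨𝔽_l^⋇⟩}`) into the diagonal submonoid of the `N`'s — the transport of the symmetrized monoids through
the log-link used at [IUTchIII] Prop 3.4 (ii) and Cor 3.12 Step (vi).
[claim: Mochizuki2012, status: disputed] (IUTchIII §1 Rmk 1.3.2, kurims pp.43–44) -/
theorem SymmetrizingIsos.map_mem_diagonal (lg : ∀ t, Ψ t → N t)
    (hlg : ∀ (t t' : T) (x : Ψ t), lg t' (σ.iso t t' x) = τ.iso t t' (lg t x))
    {S : Type w} (e : S → T) {x : ∀ s : S, Ψ (e s)} (hx : x ∈ σ.diagonal e) :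
    (fun s => lg (e s) (x s)) ∈ τ.diagonal e := by
  rw [SymmetrizingIsos.mem_diagonal_iff] at hx ⊢
  intro s s'
  rw [← hlg, hx s s']

/-- The componentwise map commutes with `toDiagonal`: transporting `m ∈ Ψ_{t₀}` to every label and then
applying the log-link is applying the log-link at `t₀` and then transporting
(`lg ∘ (Ψ_{t₀} ⥲ Ψ_{⟨S⟩}) = (N_{t₀} ⥲ N_{⟨S⟩}) ∘ lg`).
[claim: Mochizuki2012, status: disputed] (IUTchIII §1 Rmk 1.3.2, kurims pp.43–44) -/
theorem SymmetrizingIsos.map_toDiagonal (lg : ∀ t, Ψ t → N t)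
    (hlg : ∀ (t t' : T) (x : Ψ t), lg t' (σ.iso t t' x) = τ.iso t t' (lg t x))
    {S : Type w} (e : S → T) (t₀ : T) (m : Ψ t₀) :
    (fun s => lg (e s) (σ.toDiagonal e t₀ m s)) = τ.toDiagonal e t₀ (lg t₀ m) := by
  funext s
  rw [SymmetrizingIsos.toDiagonal_apply, SymmetrizingIsos.toDiagonal_apply, hlg]

/-- With the identification `Ψ_{t₀} ⥲ Ψ_{⟨S⟩}` (`diagonalIso`, nonempty `S`): the diagonal image of
`lg_{t₀} m` is the componentwise image of the diagonal image of `m`.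
[claim: Mochizuki2012, status: disputed] (IUTchIII §1 Rmk 1.3.2, kurims pp.43–44) -/
theorem SymmetrizingIsos.coe_diagonalIso_map (lg : ∀ t, Ψ t → N t)
    (hlg : ∀ (t t' : T) (x : Ψ t), lg t' (σ.iso t t' x) = τ.iso t t' (lg t x))
    {S : Type w} [Nonempty S] (e : S → T) (t₀ : T) (m : Ψ t₀) :
    ((τ.diagonalIso e t₀ (lg t₀ m) : τ.diagonal e) : ∀ s : S, N (e s))
      = fun s => lg (e s) (((σ.diagonalIso e t₀ m : σ.diagonal e) : ∀ s : S, Ψ (e s)) s) := by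
  funext s
  rw [SymmetrizingIsos.coe_diagonalIso_apply, SymmetrizingIsos.coe_diagonalIso_apply, hlg]

end Junction

/-! ## §4. A genuine `ActionTransport` at the nonarchimedean model and the equivariance of `log_p` -/

section Model

variable (p : ℕ) [Fact p.Prime]

/-- **Equivariance of `log_p` for Galois-valued transports.** For ANY `ActionTransport` on labeled copies
of one complete algebraic `p`-adic field `K` whose transports are given by Galois automorphisms
`φ γ ∈ Gal(K/ℚ_p)` (domain side, multiplicative monoid `K`) and any transports on the codomain side given
by the SAME `φ γ`, the log-link `log_p` intertwines them — the hypothesis `hlg` of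
`compatible_toSymmetrizingIsos` / `Rmk132_logLinkCompatible_of_actionTransport` at the model.
[claim: Mochizuki2012, status: disputed] (IUTchIII §1 Rmk 1.3.2, kurims pp.43–44; Rmk 1.2.2 (i) p.30) -/
theorem unitLog_actionTransport_equivariant {T : Type u} {K : Type v} [NontriviallyNormedField K]
    [NormedAlgebra ℚ_[p] K] [Algebra.IsAlgebraic ℚ_[p] K] [IsUltrametricDist K] [CompleteSpace K]
    {Γ : Type w} [Group Γ] [MulAction Γ T] (φ : Γ → (K ≃ₐ[ℚ_[p]] K))
    (A B : ActionTransport Γ (fun _ : T => K))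
    (hA : ∀ (g : Γ) (t t' : T) (h : g • t = t') (x : K), A.act g t t' h x = φ g x)
    (hB : ∀ (g : Γ) (t t' : T) (h : g • t = t') (x : K), B.act g t t' h x = φ g x)
    (g : Γ) (t t' : T) (h : g • t = t') (x : K) :
    unitLog (A.act g t t' h x) = B.act g t t' h (unitLog x) := by
  rw [hA, hB, unitLog_map_algEquiv p (φ g) x]

/-- **`log_p` is compatible with the induced symmetrizing isomorphisms** at the model (any pretransitive
label action, Galois-valued synchronized transports on both sides).
[claim: Mochizuki2012, status: disputed] (IUTchIII §1 Rmk 1.3.2, kurims pp.43–44) -/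
theorem unitLog_compatible_toSymmetrizingIsos {T : Type u} {K : Type v} [NontriviallyNormedField K]
    [NormedAlgebra ℚ_[p] K] [Algebra.IsAlgebraic ℚ_[p] K] [IsUltrametricDist K] [CompleteSpace K]
    {Γ : Type w} [Group Γ] [MulAction Γ T] [MulAction.IsPretransitive Γ T]
    (φ : Γ → (K ≃ₐ[ℚ_[p]] K)) (A B : ActionTransport Γ (fun _ : T => K))
    (hA : ∀ (g : Γ) (t t' : T) (h : g • t = t') (x : K), A.act g t t' h x = φ g x)
    (hB : ∀ (g : Γ) (t t' : T) (h : g • t = t') (x : K), B.act g t t' h x = φ g x)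
    (t t' : T) (x : K) :
    unitLog (A.toSymmetrizingIsos.iso t t' x) = B.toSymmetrizingIsos.iso t t' (unitLog x) :=
  compatible_toSymmetrizingIsos A B (fun _ => unitLog)
    (unitLog_actionTransport_equivariant p φ A B hA hB) t t' x

/-- **[IUTchIII] Rmk 1.3.2 at the model, transport form.** For Galois-valued `ActionTransport`s `A`, `B`
as above with labels, field and group in one universe, the schema `Rmk132_logLinkCompatible` holds for
the log-link `log_p` and the transports along `γ : t ↦ γ·t`.
[claim: Mochizuki2012, status: disputed] (IUTchIII §1 Rmk 1.3.2, kurims pp.43–44) -/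
theorem Rmk132_logLinkCompatible_unitLog_actionTransport {T : Type u} {K : Type u}
    [NontriviallyNormedField K] [NormedAlgebra ℚ_[p] K] [Algebra.IsAlgebraic ℚ_[p] K]
    [IsUltrametricDist K] [CompleteSpace K] {Γ : Type u} [Group Γ] [MulAction Γ T]
    (φ : Γ → (K ≃ₐ[ℚ_[p]] K)) (A B : ActionTransport Γ (fun _ : T => K))
    (hA : ∀ (g : Γ) (t t' : T) (h : g • t = t') (x : K), A.act g t t' h x = φ g x)
    (hB : ∀ (g : Γ) (t t' : T) (h : g • t = t') (x : K), B.act g t t' h x = φ g x) :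
    Rmk132_logLinkCompatible (fun _ : T => K) (fun _ => K) (fun _ => (unitLog : K → K))
      (fun γ t => (A.act γ t (γ • t) rfl).toEquiv) (fun γ t => (B.act γ t (γ • t) rfl).toEquiv) :=
  Rmk132_logLinkCompatible_of_actionTransport A B (fun _ => unitLog)
    (unitLog_actionTransport_equivariant p φ A B hA hB)

/-- **"hence also with the conjugate synchronization" at the model**: `log_p` applied componentwise
carries a family that is diagonal (conjugate-synchronized) for the symmetrizing isomorphisms induced by
`A` to a family that is diagonal for those induced by `B`.
[claim: Mochizuki2012, status: disputed] (IUTchIII §1 Rmk 1.3.2, kurims pp.43–44) -/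
theorem unitLog_map_mem_diagonal {T : Type u} {K : Type v} [NontriviallyNormedField K]
    [NormedAlgebra ℚ_[p] K] [Algebra.IsAlgebraic ℚ_[p] K] [IsUltrametricDist K] [CompleteSpace K]
    {Γ : Type w} [Group Γ] [MulAction Γ T] [MulAction.IsPretransitive Γ T]
    (φ : Γ → (K ≃ₐ[ℚ_[p]] K)) (A B : ActionTransport Γ (fun _ : T => K))
    (hA : ∀ (g : Γ) (t t' : T) (h : g • t = t') (x : K), A.act g t t' h x = φ g x)
    (hB : ∀ (g : Γ) (t t' : T) (h : g • t = t') (x : K), B.act g t t' h x = φ g x)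
    {S : Type w} (e : S → T) {x : S → K} (hx : x ∈ A.toSymmetrizingIsos.diagonal e) :
    (fun s => unitLog (x s)) ∈ B.toSymmetrizingIsos.diagonal e :=
  SymmetrizingIsos.map_mem_diagonal A.toSymmetrizingIsos B.toSymmetrizingIsos (fun _ => unitLog)
    (unitLog_compatible_toSymmetrizingIsos p φ A B hA hB) e hx

/-- **Non-vacuity of §4: a genuine (non-identity) `ActionTransport` exists at the model.** For the
regular action of any group `Γ` on itself as label set (free, so conjugate synchronization is automatic)
and any homomorphism `φ : Γ →* Gal(K/ℚ_p)`, transport along `g` by `φ g` is an `ActionTransport` on the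
labeled copies of `K`; e.g. `Γ = Gal(K/ℚ_p)`, `φ = id` gives NON-identity symmetrizing isomorphisms as
soon as `K ≠ ℚ_p` is Galois.
[claim: Mochizuki2012, status: disputed] (IUTchIII §1 Rmk 1.3.2, kurims pp.43–44; IUTchII Cor 4.5 (iii) p.132) -/
theorem exists_actionTransport_galois {K : Type v} [NontriviallyNormedField K]
    [NormedAlgebra ℚ_[p] K] {Γ : Type w} [Group Γ] (φ : Γ →* (K ≃ₐ[ℚ_[p]] K)) :
    ∃ A : ActionTransport Γ (fun _ : Γ => K),
      ∀ (g : Γ) (t t' : Γ) (h : g • t = t') (x : K), A.act g t t' h x = φ g x := by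
  refine ⟨{ act := fun g _ _ _ => (φ g : K ≃ₐ[ℚ_[p]] K).toMulEquiv
            act_one := fun t x => by simp
            act_mul := fun g g' t t' t'' h h' x => by simp [map_mul, AlgEquiv.mul_apply]
            sync := fun g t h x => ?_ }, fun g t t' h x => rfl⟩
  have hg : g = 1 := by simpa [smul_eq_mul] using h
  subst hg
  simp

end Model

end Literature.IUT.LogThetaLattice

end
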